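import Mathlib
import Summits.NavierStokesRegularity.NavierStokesRegularity.Theorems.TypeIQuarterGateScarEnvelopeTypeISatelliteTowerCriticalRate
import Summits.NavierStokesRegularity.NavierStokesRegularity.Theorems.ExtremalTypeIConstantSmallConstantLiouville

/-!
# Satellite tower for crux `ScarEnvelopeTypeI` (stmt-NavierStokesRegularity-23843) — Part R5–R7: the trap through `M_c`; the η-critical normal form of the enemy; the bridge `ε_L ≤ C_* ≤ M_c`

Part R5–R7 of nsreg-p3's ROUND-38 artefact (section `CriticalRate`): R5 `rootRate_trap_crit`, `rootRate_flat_of_critRate`,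
`critRate_le_of_infiniteRootDescent`; R6 `EtaCritical η n`, `exists_etaCritical`, ★ `etaCritical_of_not_scarEnvelopeTypeI` (if 23843 fails,
`M_c ∈ [ε_L, M]` and every class `M_c + η` has a root object), `scarEnvelopeTypeI_of_noScar` ((L′₀) ⇒ 23843), `scarEnvelopeTypeI_or_scarClasses`;
R7 `liouvilleClasses` / `liouvilleRate` (route ExtremalTypeIConstant's least admissible constant `C_*`), `liouvilleRate_le_critRate`,
`epsL_le_liouvilleRate`, `rate_chain : ε_L ≤ C_* ≤ M_c ≤ M`.

PROVENANCE: declaration texts VERBATIM from the HOME artefact of the instrument seat nsreg-p3 g27 (cell `pub/ns-regularity-ideate`):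
`round-38/CritRate38.lean` (sha16 `30eed4aabab5065a`, a standalone module written against the TREE; memo `round-38/ROUND-38.md`
4eff55037f29b2fe), scored by referee ref3 g27 (`SCORE-p3-ROUND-38-0828.md`); the author cannot write under `Theorems/`
(`perm.theorems-prover-only`); landed by the prover ns-es-p1 g5 as landing hand of record (director-ns DIRECTOR-NS #237 (3)), split into
≤ 400-line modules, `E3` spelled out, the artefact's `#guard_msgs … #print axioms` certificates not landed.
`--supports stmt-NavierStokesRegularity-23843 --as helper`.

HONEST FRAMING: instrument theorems about HYPOTHETICAL Type-I zoom limits (Albritton–Barker objects of the census of crux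
`TypeIQuarterGate.ScarEnvelopeTypeI`, item 23843); the analytic input is the tree's closure engine (compactness
`local_typeI_compactness_twin_inBall`, sharpened to constant 1 in Part S1; Q1 whole-space), P1 rate inheritance, L8 persistence and the
tree's PROVED small-constant Liouville theorem; Parts R/S are order theory on the re-classing and closure lemmas.  NOTHING OPEN IS
PROVED: 23843, (L′) `TypeILiouvilleAB` / (L′₀), the GLOBAL (S∞) = `CritAttained`, (M𝐈₁), (E1⁺), (E2ᵣ), route ExtremalTypeIConstant's
cruxes, N0 and Navier–Stokes regularity are OPEN; `critRate`, `levelCrit I`, `liouvilleRate` are `sInf`s that are `0` by junk value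
when the defining set is empty (every statement using them carries the nonemptiness hypothesis explicitly).
-/

-- the summit-side namespace repeats a component by design (single-conjunct summit, D-0017)
set_option linter.dupNamespace false

open MeasureTheory Set Metric Filter Topology
open scoped ENNReal NNReal InnerProductSpace
open Literature.Analysis.FluidPDE

namespace Summit.NavierStokesRegularity.NavierStokesRegularity.Cruxes.ScarEnvelopeTypeI.ZoomDictionary

section CriticalRate

open Summit.NavierStokesRegularity.NavierStokesRegularity.Theorems (smallConstantLiouville_eq_zero)

variable {U : ℝ → (EuclideanSpace ℝ (Fin 3)) → (EuclideanSpace ℝ (Fin 3))} {P : ℝ → (EuclideanSpace ℝ (Fin 3)) → ℝ}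

/-! ### R5. The trap re-read through `M_c` -/

/-- ★ **The trap, critical form.**  Along every infinite root descent of ANY class `M` the tight root
rates decrease to a limit `m_∞ ∈ [M_c, M]` (and `M_c ≥ ε_L`): Part Q's `rootRate_trap'` with the floor
`ε_L` replaced by the larger, class-free `M_c`. -/
theorem rootRate_trap_crit {M : ℝ} {c : ℕ → TNode}
    (hc : ∀ k, RootObj M (c k) ∧ ¬ TameRoot (c k) ∧ RootDescends (c k) (c (k + 1))) :
    ∃ m : ℝ, m ∈ Icc critRate M ∧ Antitone (fun k => tightRate (c k).U 0) ∧
      (∀ k, tightRate (c k).U 0 ∈ Icc m M) ∧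
      Tendsto (fun k => tightRate (c k).U 0) atTop (𝓝 m) := by
  obtain ⟨m, hm, hle, ht⟩ := rootRate_tendsto hc
  have hcrit : ∀ k, critRate ≤ tightRate (c k).U 0 := fun k =>
    critRate_le_tightRate (hc k).1.1 (hc k).1.2
  exact ⟨m, ⟨ge_of_tendsto' ht hcrit, hm.2⟩, rootRate_antitone hc,
    fun k => ⟨hle k, (rootRate_mem_Icc hc k).2⟩, ht⟩

/-- In the critical class the rate ladder of every infinite root descent is FLAT (`≡ M_c`). -/
theorem rootRate_flat_of_critRate {c : ℕ → TNode}
    (hc : ∀ k, RootObj critRate (c k) ∧ ¬ TameRoot (c k) ∧ RootDescends (c k) (c (k + 1))) (k : ℕ) :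
    tightRate (c k).U 0 = critRate :=
  (hc k).1.1.tightRate_eq_critRate (hc k).1.2

/-- An infinite root descent in a class `M` forces `M_c ≤ M` (its levels are scars of class `M`). -/
theorem critRate_le_of_infiniteRootDescent {M : ℝ} (h : InfiniteRootDescent M) : critRate ≤ M := by
  obtain ⟨c, hc⟩ := h
  exact critRate_le_of_nonempty ⟨_, (c 0).U, (c 0).P, (c 0).H, 0, (hc 0).1.1, (hc 0).1.2, rfl⟩

/-! ### R6. The η-CRITICAL normal form of the enemy of 23843 -/

/-- An **η-CRITICAL ROOT OBJECT**: a root object (A–B object singular at the final-time origin) of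
class `M_c + η` — GLOBAL Type-I constant within `η` of the critical scar rate. -/
def EtaCritical (η : ℝ) (n : TNode) : Prop := RootObj (critRate + η) n

/-- Its root scar (indeed every scar of it) has tight rate in `[M_c, M_c + η]`: it is η-SATURATED —
the global constant exceeds the local rate at the scar by at most `η`. -/
theorem EtaCritical.tightRate_mem {η : ℝ} {n : TNode} (h : EtaCritical η n) {y : (EuclideanSpace ℝ (Fin 3))}
    (hy : ¬ RegPt n.U y) : tightRate n.U y ∈ Icc critRate (critRate + η) :=
  ⟨critRate_le_tightRate h.1 hy, (towerObj_of_abTower h.1).tightRate_le y⟩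

/-- η-critical root objects are equi-rated at level `(M_c, η)` in the sense of ROUND-34. -/
theorem EtaCritical.equiRated {η : ℝ} {n : TNode} (h : EtaCritical η n) :
    EquiRated (critRate + η) critRate η n :=
  ⟨h.1, h.2, fun y _ => rateAt_of_hasTypeITimeDecay h.1.1.2.2.2 y,
    fun _ hy => critRate_le_tightRate h.1 hy⟩

/-- ★ **η-critical root objects exist for every `η > 0`** as soon as some class carries a scar:
re-class a scar of class `M_c + η` (which exists, `M_c` being an infimum). -/
theorem exists_etaCritical (h : scarClasses.Nonempty) {η : ℝ} (hη : 0 < η) :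
    ∃ n : TNode, EtaCritical η n := by
  obtain ⟨r, U, P, H, y, hAB, hy, -⟩ := singRates_nonempty_of_critRate_lt h (lt_add_of_pos_right _ hη)
  obtain ⟨n, hn⟩ := hAB.exists_rootObj_tightRate hy
  exact ⟨n, hn.1.mono ((towerObj_of_abTower hAB).tightRate_le y), hn.2⟩

/-- ★★ **THE η-CRITICAL NORMAL FORM OF THE ENEMY OF 23843.**  If `ScarEnvelopeTypeI` fails, then some
A–B class carries a final-time scar, the critical scar rate is a number `M_c ≥ ε_L`, it is `≤` the rate
`M` of the violating zoom class, and for EVERY `η > 0` there is an η-critical root object: an A–B object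
with GLOBAL constant `≤ M_c + η`, singular at the origin, all of whose scars have tight rate in
`[M_c, M_c + η]`.  (The minimal twin-scar enemy is an almost-minimiser of the Type-I constant among
scar-carrying A–B flows.)  Nothing open is proved. -/
theorem etaCritical_of_not_scarEnvelopeTypeI
    (h : ¬ Summit.NavierStokesRegularity.NavierStokesRegularity.Theses.TypeIQuarterGate.ScarEnvelopeTypeI) :
    ∃ M : ℝ, (singRates M).Nonempty ∧ critRate ∈ Icc epsL M ∧
      ∀ η : ℝ, 0 < η → ∃ n : TNode, EtaCritical η n := by
  obtain ⟨M, U, P, H, e, hAB, -, h0, -, -⟩ := exists_abTower_of_not_scarEnvelopeTypeI h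
  have hne : (singRates M).Nonempty := ⟨_, U, P, H, 0, hAB, h0, rfl⟩
  exact ⟨M, hne, ⟨epsL_le_critRate ⟨M, hne⟩, critRate_le_of_nonempty hne⟩,
    fun η hη => exists_etaCritical ⟨M, hne⟩ hη⟩

/-- **Contrapositive census ((L′₀) ⇒ 23843).**  If NO A–B class carries a final-time scar, then
`ScarEnvelopeTypeI` holds. ((L′₀) is implied by (L′) `TypeILiouvilleAB`; both OPEN.) -/
theorem scarEnvelopeTypeI_of_noScar (h : ∀ M : ℝ, singRates M = ∅) :
    Summit.NavierStokesRegularity.NavierStokesRegularity.Theses.TypeIQuarterGate.ScarEnvelopeTypeI := by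
  by_contra h'
  obtain ⟨M, U, P, H, e, hAB, -, h0, -, -⟩ := exists_abTower_of_not_scarEnvelopeTypeI h'
  have hm : tightRate U 0 ∈ singRates M := ⟨U, P, H, 0, hAB, h0, rfl⟩
  rw [h M] at hm
  simp at hm

/-- Equivalently: 23843 holds unless the critical scar rate is REALISED as a bona fide infimum of a
nonempty set of classes, `M_c ≥ ε_L`. -/
theorem scarEnvelopeTypeI_or_scarClasses :
    Summit.NavierStokesRegularity.NavierStokesRegularity.Theses.TypeIQuarterGate.ScarEnvelopeTypeI ∨
      (scarClasses.Nonempty ∧ epsL ≤ critRate ∧ ∀ η : ℝ, 0 < η → ∃ n : TNode, EtaCritical η n) := by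
  by_cases h : Summit.NavierStokesRegularity.NavierStokesRegularity.Theses.TypeIQuarterGate.ScarEnvelopeTypeI
  · exact Or.inl h
  · obtain ⟨M, hne, hc, hη⟩ := etaCritical_of_not_scarEnvelopeTypeI h
    exact Or.inr ⟨⟨M, hne⟩, hc.1, hη⟩

/-! ### R7. The bridge to route ExtremalTypeIConstant: `ε_L ≤ C_* ≤ M_c` -/

/-- The Type-I constants whose KNSS-gauge class `A_C` (`IsTypeIAncientMild C`: smooth, divergence-free,
Oseen-mild between all pairs of times, `‖u‖ ≤ C/√(−t)`; NO energy clause) has a NONTRIVIAL element —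
the admissible constants of route ExtremalTypeIConstant (whose PROVED `MinimiserExists`, stmt-8217,
says their infimum is attained). -/
def liouvilleClasses : Set ℝ :=
  {C | ∃ u : ℝ → (EuclideanSpace ℝ (Fin 3)) → (EuclideanSpace ℝ (Fin 3)), IsTypeIAncientMild C u ∧ ∃ t < 0, ∃ x, u t x ≠ 0}

/-- The **Liouville-critical constant** `C_*` (`= 0` by junk value if every class is trivial, i.e. under (L′)). -/
noncomputable def liouvilleRate : ℝ := sInf liouvilleClasses

/-- `liouvilleClasses` is bounded below (by `0`). -/
theorem liouvilleClasses_bddBelow : BddBelow liouvilleClasses :=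
  ⟨0, fun C ⟨u, hu, _⟩ => by
    have h := hu.2.2.2 (-1) (by norm_num) 0
    rw [neg_neg, Real.sqrt_one, div_one] at h
    exact (norm_nonneg _).trans h⟩

/-- A flow with a singular final-time point does not vanish on the open past. -/
theorem exists_ne_zero_of_not_regPt {y : (EuclideanSpace ℝ (Fin 3))} (hy : ¬ RegPt U y) : ∃ t < 0, ∃ x, U t x ≠ 0 := by
  by_contra h
  push Not at h
  exact hy (regPt_of_eq_zero h y)

/-- Every scar-carrying class constant is an admissible constant of route ExtremalTypeIConstant. -/
theorem scarClasses_subset_liouvilleClasses : scarClasses ⊆ liouvilleClasses :=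
  fun _ ⟨_, U, _, _, _, hAB, hy, _⟩ => ⟨U, hAB.1, exists_ne_zero_of_not_regPt hy⟩

/-- ★ `C_* ≤ M_c`: the Liouville-critical constant is at most the critical scar rate (when some class
carries a scar). Equality is OPEN (it would follow from the extremal flow carrying a scar). -/
theorem liouvilleRate_le_critRate (h : scarClasses.Nonempty) : liouvilleRate ≤ critRate :=
  csInf_le_csInf liouvilleClasses_bddBelow h scarClasses_subset_liouvilleClasses

/-- `ε_L ≤ C_*` by the tree's small-constant Liouville theorem (`smallConstantLiouville_eq_zero`). -/
theorem epsL_le_liouvilleRate (h : liouvilleClasses.Nonempty) : epsL ≤ liouvilleRate :=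
  le_csInf h fun C ⟨u, hu, t, ht, x, hx⟩ => by
    by_contra hlt
    exact hx (smallConstantLiouville_eq_zero hu (lt_of_not_ge hlt) ht x)

/-- The chain `ε_L ≤ C_* ≤ M_c ≤ M` for every scar-carrying class `M`. -/
theorem rate_chain {M : ℝ} (hne : (singRates M).Nonempty) :
    epsL ≤ liouvilleRate ∧ liouvilleRate ≤ critRate ∧ critRate ≤ M :=
  ⟨epsL_le_liouvilleRate (Set.Nonempty.mono scarClasses_subset_liouvilleClasses ⟨M, hne⟩),
    liouvilleRate_le_critRate ⟨M, hne⟩, critRate_le_of_nonempty hne⟩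

end CriticalRate

end Summit.NavierStokesRegularity.NavierStokesRegularity.Cruxes.ScarEnvelopeTypeI.ZoomDictionary
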